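import Summits.QuantumFields.YangMills.Theorems.LangevinControlUVFemtoCurvatureTwoPointCReduction
import Summits.QuantumFields.YangMills.Theorems.LangevinControlUVFemtoCurvatureTwoPointCDefsProfiles
import Summits.QuantumFields.YangMills.Theorems.LangevinControlUVFemtoCurvatureTwoPointCStubPairsOfProfiles

/-!
# Route `LangevinControlUV`, crux `FemtoCurvatureTwoPointC` (stmt-QuantumFields-16204), line `Sketch` — reshape v4 bridge:
# `AFProfilesAt r → AFCouplingAt r → CruxCAt r`

Continuation lead `prover-line-stmt-QuantumFields-16204-c3-0`, cycle 5. The diagonal-profile form of the physics statement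
(`AFProfilesAt`, `…CDefsProfiles`, p127265) implies the all-pairs form (`AFCouplingAt`, `…CDefs`) for EVERY compact `G`
(any Borel structure) and every lattice representation `r` — pure bookkeeping on top of the landed reflection-positivity
bridge `stub_pairsOfProfiles` (`…CStubPairsOfProfiles`): shrink the window height to `w = min u₀ (1/(4(|κ₂|+1)))` (all
clauses have the window as a HYPOTHESIS, so a smaller height only weakens them), raise the threshold to `max β₀ 0`
(reflection positivity wants `β ≥ 0`), keep `u, κ₁, κ₂, κ₃, c`, and take `C' = 3·2¹⁸·max C 0`; the two-sided axis clause of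
`AFCouplingAt` is transverse lower + transverse upper at `s = n ≤ L/8` (where `max 8 (min L (8n)) = 8n`), and the pair
clause is `stub_pairsOfProfiles`. Composed with the cycle-1 reduction (`cruxCAt_of_afCouplingAt`,
`femtoCurvatureTwoPointC_of_afCoupling`, p123348):

  `AFProfiles → FemtoCurvatureTwoPointC`   (`femtoCurvatureTwoPointC_of_afProfiles`, registered sub-goal),

so the crux closes the moment the registered stub `stub_afProfiles` (= `AFProfiles`, `afProfiles_iff_stub`) lands.
Nothing is asserted here; no `sorry`. Deliberately NOT here: any claim about `AFProfilesAt` itself (open; crux-sized).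
-/

set_option autoImplicit false

noncomputable section

open Filter Topology MeasureTheory
open Literature.MathematicalPhysics.QuantumFieldTheory

namespace Summit.QuantumFields.YangMills.Theorems.FemtoCurvatureTwoPointC

/-- **Profiles give pairs (per datum).** `AFProfilesAt r → AFCouplingAt r` for every compact group `G` and lattice
representation `r`: window height `min u₀ (1/(4(|κ₂|+1)))`, threshold `max β₀ 0`, pair constant `3·2¹⁸·max C 0`; the axis
clause is transverse lower + transverse upper at `s = n`, the pair clause is the landed `stub_pairsOfProfiles`. -/
theorem afCouplingAt_of_afProfilesAt {G : Type} [Group G] [TopologicalSpace G] [IsTopologicalGroup G] [CompactSpace G]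
    [MeasurableSpace G] [BorelSpace G] (r : LatticeRep G) (h : AFProfilesAt r) : AFCouplingAt r := by
  obtain ⟨u, u₀, β₀, κ₁, κ₂, κ₃, c, C, hu₀, hc, hκ₁, hκ₃, hpos, hcont, hfrz, hcomp, hstep, hTL, hTU, hLU, hV⟩ := h
  -- the shrunk window height and the raised threshold
  set w : ℝ := min u₀ (1 / (4 * (|κ₂| + 1))) with hw_def
  have hK : 0 < |κ₂| + 1 := by positivity
  have hw₀ : w ≤ u₀ := min_le_left _ _
  have hwpos : 0 < w := lt_min hu₀ (by positivity)
  have hwκ : w * (|κ₂| + 1) ≤ 1 / 4 := by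
    have h1 : w ≤ 1 / (4 * (|κ₂| + 1)) := min_le_right _ _
    calc w * (|κ₂| + 1) ≤ 1 / (4 * (|κ₂| + 1)) * (|κ₂| + 1) :=
          mul_le_mul_of_nonneg_right h1 hK.le
      _ = 1 / 4 := by field_simp
  set β₁ : ℝ := max β₀ 0 with hβ₁_def
  have hβ₁₀ : β₀ ≤ β₁ := le_max_left _ _
  have hβ₁nn : 0 ≤ β₁ := le_max_right _ _
  set C' : ℝ := 3 * 2 ^ 18 * max C 0 with hC'_def
  have hC0 : 0 ≤ max C 0 := le_max_right _ _
  have hCC' : C ≤ C' := by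
    have h1 : C ≤ max C 0 := le_max_left _ _
    have h2 : max C 0 ≤ 3 * 2 ^ 18 * max C 0 := by nlinarith
    exact h1.trans h2
  -- windows w.r.t. `w` are windows w.r.t. `u₀`
  have hwin_mono : ∀ (L : ℕ) (β : ℝ), (∀ M : ℕ, 8 ≤ M → M ≤ L → u M β ≤ w) →
      ∀ M : ℕ, 8 ≤ M → M ≤ L → u M β ≤ u₀ := fun L β h M h8 hM => (h M h8 hM).trans hw₀
  -- clauses with `C` replaced by `max C 0` and threshold `β₁`
  have hTU' : ∀ (L : ℕ) [NeZero L] (β : ℝ) (s : ℕ), β₁ ≤ β → 1 ≤ s → 2 * s ≤ L →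
      (∀ M : ℕ, 8 ≤ M → M ≤ L → u M β ≤ u₀) →
      ∀ (P : (Fin 4 → ZMod L) → Fin 4 → Fin 4 → GaugeConfig 4 L G → ℝ)
        (E : (GaugeConfig 4 L G → ℝ) → ℝ),
        (P = fun x i j U => (r.N : ℝ) - (r.ρ (plaquetteHolonomy U x i j)).trace.re) →
        (E = fun F => wilsonExpectation r.ρ β F) →
        (s : ℝ) ^ 8 * (E (fun U => P 0 0 1 U * P (Pi.single (2 : Fin 4) ((s : ℕ) : ZMod L)) 0 1 U)
            - E (P 0 0 1) * E (P (Pi.single (2 : Fin 4) ((s : ℕ) : ZMod L)) 0 1)) ≤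
          max C 0 * u (max 8 (min L (8 * s))) β ^ 2 := by
    intro L _ β s hβ hs hsL hwin P E hP hE
    exact (hTU L β s (hβ₁₀.trans hβ) hs hsL hwin P E hP hE).trans
      (mul_le_mul_of_nonneg_right (le_max_left _ _) (sq_nonneg _))
  have hLU' : ∀ (L : ℕ) [NeZero L] (β : ℝ) (s : ℕ), β₁ ≤ β → 1 ≤ s → 2 * s ≤ L →
      (∀ M : ℕ, 8 ≤ M → M ≤ L → u M β ≤ u₀) →
      ∀ (P : (Fin 4 → ZMod L) → Fin 4 → Fin 4 → GaugeConfig 4 L G → ℝ)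
        (E : (GaugeConfig 4 L G → ℝ) → ℝ),
        (P = fun x i j U => (r.N : ℝ) - (r.ρ (plaquetteHolonomy U x i j)).trace.re) →
        (E = fun F => wilsonExpectation r.ρ β F) →
        (s : ℝ) ^ 8 * |E (fun U => P 0 0 1 U * P (Pi.single (0 : Fin 4) ((s : ℕ) : ZMod L)) 0 1 U)
            - E (P 0 0 1) * E (P (Pi.single (0 : Fin 4) ((s : ℕ) : ZMod L)) 0 1)| ≤
          max C 0 * u (max 8 (min L (8 * s))) β ^ 2 := by
    intro L _ β s hβ hs hsL hwin P E hP hE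
    exact (hLU L β s (hβ₁₀.trans hβ) hs hsL hwin P E hP hE).trans
      (mul_le_mul_of_nonneg_right (le_max_left _ _) (sq_nonneg _))
  have hV' : ∀ (L : ℕ) [NeZero L] (β : ℝ), β₁ ≤ β → (∀ M : ℕ, 8 ≤ M → M ≤ L → u M β ≤ u₀) →
      ∀ (P : (Fin 4 → ZMod L) → Fin 4 → Fin 4 → GaugeConfig 4 L G → ℝ)
        (E : (GaugeConfig 4 L G → ℝ) → ℝ),
        (P = fun x i j U => (r.N : ℝ) - (r.ρ (plaquetteHolonomy U x i j)).trace.re) →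
        (E = fun F => wilsonExpectation r.ρ β F) →
        E (fun U => P 0 0 1 U * P 0 0 1 U) - E (P 0 0 1) * E (P 0 0 1) ≤ max C 0 * u 8 β ^ 2 := by
    intro L _ β hβ hwin P E hP hE
    exact (hV L β (hβ₁₀.trans hβ) hwin P E hP hE).trans
      (mul_le_mul_of_nonneg_right (le_max_left _ _) (sq_nonneg _))
  refine ⟨u, w, β₁, κ₁, κ₂, κ₃, c, C', hwpos, hc, hκ₁, hκ₃,
    fun L β hL hβ => hpos L β hL (hβ₁₀.trans hβ),
    fun L hL => (hcont L hL).mono (Set.Ici_subset_Ici.2 hβ₁₀),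
    fun L hL => hfrz L hL,
    fun L L' β hβ hL hLL' hL'L hwin => hcomp L L' β (hβ₁₀.trans hβ) hL hLL' hL'L (hwin_mono L β hwin),
    fun k m β hβ hwin => hstep k m β (hβ₁₀.trans hβ) (hwin_mono _ β hwin), ?_, ?_⟩
  · -- two-sided axis clause: transverse lower + transverse upper at `s = n`
    intro L _ β n hβ hn hnL hwin P E hP hE
    refine ⟨hTL L β n (hβ₁₀.trans hβ) hn hnL (hwin_mono L β hwin) P E hP hE, ?_⟩
    have h2n : 2 * n ≤ L := by omega
    have hsc : max 8 (min L (8 * n)) = 8 * n := by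
      rw [Nat.min_eq_right hnL, Nat.max_eq_right (by omega)]
    have h := hTU L β n (hβ₁₀.trans hβ) hn h2n (hwin_mono L β hwin) P E hP hE
    rw [hsc] at h
    exact h.trans (mul_le_mul_of_nonneg_right hCC' (sq_nonneg _))
  · -- all pairs: the landed bridge
    intro L _ β hβ hwin P E hP hE x y i j i' j' hxy hij hij'
    have h := stub_pairsOfProfiles G r.N r.ρ r.continuous u u₀ w β₁ κ₂ (max C 0) hC0 hβ₁nn hw₀ hwκ
      (fun L β hL hβ => hpos L β hL (hβ₁₀.trans hβ))
      (fun L L' β hβ hL hLL' hL'L hwin => hcomp L L' β (hβ₁₀.trans hβ) hL hLL' hL'L hwin)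
      hTU' hLU' hV' L β hβ hwin P E hP hE x y i j i' j' hxy hij hij'
    simpa only [hC'_def, mul_assoc] using h

/-- **Profiles give pairs (universal closure).** `AFProfiles → AFCoupling`. -/
theorem afCoupling_of_afProfiles (h : AFProfiles) : AFCoupling :=
  fun G _ _ _ _ _ _ hG r => afCouplingAt_of_afProfilesAt r (h G hG r)

/-- **Reduction at fixed data, v4.** `AFProfilesAt r → CruxCAt r` for every compact group `G` and lattice representation
`r` (bridge, then the cycle-1 reduction `cruxCAt_of_afCouplingAt`). -/
theorem cruxCAt_of_afProfilesAt {G : Type} [Group G] [TopologicalSpace G] [IsTopologicalGroup G] [CompactSpace G]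
    [MeasurableSpace G] [BorelSpace G] (r : LatticeRep G) (h : AFProfilesAt r) : CruxCAt r :=
  cruxCAt_of_afCouplingAt r (afCouplingAt_of_afProfilesAt r h)

/-- **Registered sub-goal `femtoCurvatureTwoPointC_of_afProfiles` (crux stmt-QuantumFields-16204, line `Sketch`, v4): the
crux in continuous intrinsic units follows from the diagonal-profile physics statement.** `AFProfiles → FemtoCurvatureTwoPointC`
— the closing theorem for the crux once `AFProfiles` (registered stub `stub_afProfiles`) is proved. -/
theorem femtoCurvatureTwoPointC_of_afProfiles :
    AFProfiles → Summit.QuantumFields.YangMills.Theses.LangevinControlUV.FemtoCurvatureTwoPointC :=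
  fun h => femtoCurvatureTwoPointC_of_afCoupling (afCoupling_of_afProfiles h)

end Summit.QuantumFields.YangMills.Theorems.FemtoCurvatureTwoPointC

end
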